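import Literature.AnabelianGeometry.AbsoluteAnabelian.ArchimedeanHolFieldFunctorGeometricPSLArithmeticCusps
import Literature.NumberTheory.Automorphic.FuchsianCompactCore
import HarnessLib

/-!
# (P), (FC) and `[N(Γ̄) : Γ̄] < ∞` for every FINITE-COVOLUME torsion-free Fuchsian `Γ̄ ≤ PSL₂(ℝ)` (PROOF-ONLY)

abc-iut cell, LINEAGE ROW «GENUINE-BASE-COVOLUME» steps S1 + S2 (GO abc-iut-L4-lead m90), seat
abc-iut-L4-d1; sequel of `…PSLArithmeticCusps.lean` (arithmetic `Γ̄`) with arithmeticity replaced by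
FINITE COVOLUME.  S. Mochizuki, *Topics in Absolute Anabelian Geometry III*, proof of Prop. 4.2 (i)
p. 106: over a hyperbolic curve the automorphism groups `N_{PSL₂(ℝ)}(Λ̄)/Λ̄` of the finite étale
localisations are finite — the `hN` binder of the tree's geometric column (abc-iut-L4-t14), which after
`…PSLHfinFree.lean` is the ONLY residual at a uniformised base `X = ℍ/Γ̄` («Aut-finiteness of finite
covers», L4-lead m86).  abc-iut-L4-d1's `finiteIndex_subgroupOf_normalizer_of_cusps` reduces `hN` to the
cusp data (P) + (FC); here both are DISCHARGED for every `Γ̄` acting properly discontinuously on `ℍ`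
whose lift `toGL(π⁻¹ Γ̄) ≤ GL(2, ℝ)` has a measurable fundamental domain of FINITE hyperbolic area, from
the tree's theory of general Fuchsian groups (`Literature/NumberTheory/Automorphic/Fuchsian*.lean`,
H. Iwaniec, *Spectral Methods of Automorphic Forms*, §2.1–2.2; Siegel's theorem in thick–thin form):

* §1 `isDiscreteSubgroup_map_toGL_of_discreteTopology` — a discrete `S ≤ SL(2, ℝ)` is discrete in
  Iwaniec's norm-ball sense after `toGL` (compact ∩ discrete is finite); `isDiscreteSubgroup_map_toGL_comap`
  (for `Γ̄` properly discontinuous, via abc-iut-L4-d1's `discreteTopology_comap_psl`);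
  `neg_one_mem_map_toGL_comap`, `map_toGL_comap_le_range` (the side conditions of the Fuchsian files).
* §2 `exists_parabolic_of_isCusp` ((P) ⟸ one cusp) and ★ `exists_finset_cusps_of_finite_cuspOrbits`
  ((FC) ⟸ `Finite (CuspOrbits (toGL(π⁻¹ Γ̄)))` — the NORMAL FORM of (FC), by the eigenline ↔ `ℙ¹(ℝ)`
  dictionary of `…PSLArithmeticCusps.lean` §1).
* §3 ★ `exists_finset_cusps_of_finite_covolume` ((FC) ⟸ finite covolume: the tree's
  `Fuchsian.finite_cuspOrbits`), ★ `exists_isCusp_of_not_compactSpace` (a cusp EXISTS when `ℍ/Γ̄` is not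
  compact: the tree's compact core `Fuchsian.exists_cuspSystem_and_compact_core` — with no cusps every
  orbit meets a compact `K`), ★★ `finiteIndex_subgroupOf_normalizer_of_finite_covolume(_of_le)` — `hN` for
  `Γ̄` and for every non-abelian finite-index `Λ̄ ≤ Γ̄` from FINITE COVOLUME + NON-COMPACTNESS — and
  ★★ `finiteIndex_subgroupOf_normalizer_of_finite_covolume_of_le'` — the compact/non-compact dichotomy
  removed (compact case: abc-iut-L4-d1's `finiteIndex_subgroupOf_normalizer_of_compactSpace`): **`hN` at
  every object of `Loc(PSL₂(ℝ), Γ̄)` for EVERY non-abelian finite-covolume `Γ̄` acting properly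
  discontinuously on `ℍ`.**

What remains for a genuine punctured base `X` (`ℂ ∖ F`, `E ∖ {x₀}`; abc-iut-w6-d031's junction gives
`X ≅ ℍ/Λ̄`): a fundamental domain of finite area for `toGL(π⁻¹ Λ̄)` (the tree's
`exists_isHypFundamentalDomain_of_isDiscreteSubgroup` gives a measurable one; its FINITE AREA = step S3,
held) — or abc-iut-w6-d031's direct route to (P)/(FC) (row «GENUINE-CUSPDATA»), which targets
`exists_finset_cusps_of_finite_cuspOrbits` as normal form.  No definitions, no instances, no named facts.
HONEST FRAMING: classical; MODEL side of [AbsTopIII] §4 — model ≠ reconstruction; nothing here bears on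
the disputed [IUTchIII] Cor. 3.12.

## References

* S. Mochizuki, *Topics in Absolute Anabelian Geometry III* (2015), proof of Prop. 4.2 (i) p. 106.
  [MochizukiAbsTopIII2015]
* H. Iwaniec, *Spectral Methods of Automorphic Forms*, 2nd ed., GSM 53 (2002), §2.1–§2.2, Prop. 2.3–2.5.
  [Iwaniec2002]
* G. Shimura, *Introduction to the Arithmetic Theory of Automorphic Functions* (1971), §1.5. [Shimura1971]
* H. M. Farkas, I. Kra, *Riemann Surfaces*, 2nd ed. (1992), IV.5.6. [FarkasKra1992]
-/

set_option autoImplicit false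

noncomputable section

open scoped UpperHalfPlane MatrixGroups Matrix Topology Pointwise ENNReal
open _root_.MulAction _root_.MeasureTheory
open Matrix.SpecialLinearGroup (toGL)
open Literature.NumberTheory.Automorphic (IsDiscreteSubgroup IsHypFundamentalDomain)

namespace Literature.AnabelianGeometry.AbsoluteAnabelian

namespace HolRS

/-! ### §1 Discreteness currencies and the lift `toGL(π⁻¹ Γ̄)` -/

/-- A discrete subgroup `S ≤ SL(2, ℝ)` is discrete in Iwaniec's norm-ball sense after `toGL`: the
elements of bounded entries form a compact, discrete — hence finite — set.
[cite: Iwaniec2002, §2.1, PDF p. 27] -/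
theorem isDiscreteSubgroup_map_toGL_of_discreteTopology (S : Subgroup SL(2, ℝ)) [DiscreteTopology S] :
    IsDiscreteSubgroup (S.map (toGL : SL(2, ℝ) →* GL (Fin 2) ℝ)) := by
  rw [Literature.NumberTheory.Automorphic.Fuchsian.isDiscreteSubgroup_iff_finite_abs_le]
  intro R
  -- the compact set of matrices with entries bounded by `R`, pulled back to `S`
  have hB : IsCompact ({M | ∀ i j, |M i j| ≤ R} : Set (Fin 2 → Fin 2 → ℝ)) := by
    have : ({M | ∀ i j, |M i j| ≤ R} : Set (Fin 2 → Fin 2 → ℝ)) =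
        Set.pi Set.univ fun _ : Fin 2 => Set.pi Set.univ fun _ : Fin 2 => Set.Icc (-R) R := by
      ext M
      simp only [Set.mem_setOf_eq, Set.mem_univ_pi, Set.mem_Icc, abs_le]
    rw [this]
    exact isCompact_univ_pi fun _ => isCompact_univ_pi fun _ => isCompact_Icc
  have hBS : IsCompact {s : S | ∀ i j, |((s : SL(2, ℝ)) : Matrix (Fin 2) (Fin 2) ℝ) i j| ≤ R} := by
    have hemb : Topology.IsClosedEmbedding
        (fun s : S => ((s : SL(2, ℝ)) : Matrix (Fin 2) (Fin 2) ℝ)) :=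
      Matrix.SpecialLinearGroup.isClosedEmbedding_val.comp
        (Subgroup.isClosed_of_discrete (H := S)).isClosedEmbedding_subtypeVal
    exact hemb.isCompact_preimage hB
  have hfin : {s : S | ∀ i j, |((s : SL(2, ℝ)) : Matrix (Fin 2) (Fin 2) ℝ) i j| ≤ R}.Finite :=
    hBS.finite_of_discrete
  refine ((hfin.image fun s : S => (toGL (s : SL(2, ℝ)) : GL (Fin 2) ℝ))).subset ?_
  rintro γ ⟨hγ, hR⟩
  obtain ⟨s, hs, rfl⟩ := Subgroup.mem_map.mp hγ
  exact ⟨⟨s, hs⟩, fun i j => hR i j, rfl⟩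

variable (Γ : Subgroup PSL2R)

/-- `-1 ∈ toGL(π⁻¹ Γ̄)` (`π(-1) = 1`). [cite: FarkasKra1992, IV.5.6] -/
theorem neg_one_mem_map_toGL_comap :
    (-1 : GL (Fin 2) ℝ) ∈ ((Γ.comap (QuotientGroup.mk' (Subgroup.center SL(2, ℝ)))).map
      (toGL : SL(2, ℝ) →* GL (Fin 2) ℝ)) := by
  refine Subgroup.mem_map.mpr ⟨-1, ?_, ?_⟩
  · change (QuotientGroup.mk' (Subgroup.center SL(2, ℝ)) (-1) : PSL2R) ∈ Γ
    have : (QuotientGroup.mk' (Subgroup.center SL(2, ℝ)) (-1) : PSL2R) = 1 := by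
      rw [QuotientGroup.mk'_apply, ← QuotientGroup.mk_one, QuotientGroup.eq, mul_one]
      exact (Subgroup.center SL(2, ℝ)).inv_mem (mem_center_sl_iff.mpr (Or.inr rfl))
    rw [this]
    exact Γ.one_mem
  · refine Units.ext ?_
    simp [Matrix.SpecialLinearGroup.coe_GL_coe_matrix]

/-- `toGL(π⁻¹ Γ̄) ≤ toGL(SL(2, ℝ))`. [cite: FarkasKra1992, IV.5.6] -/
theorem map_toGL_comap_le_range :
    ((Γ.comap (QuotientGroup.mk' (Subgroup.center SL(2, ℝ)))).map (toGL : SL(2, ℝ) →* GL (Fin 2) ℝ)) ≤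
      (toGL : SL(2, ℝ) →* GL (Fin 2) ℝ).range :=
  Subgroup.map_le_range _ _

/-- For `Γ̄` acting properly discontinuously on `ℍ`, `toGL(π⁻¹ Γ̄)` is discrete in Iwaniec's sense
(abc-iut-L4-d1's `discreteTopology_comap_psl` + `isDiscreteSubgroup_map_toGL_of_discreteTopology`).
[cite: Iwaniec2002, §2.1, PDF p. 27] -/
theorem isDiscreteSubgroup_map_toGL_comap [ProperlyDiscontinuousSMul Γ ℍ] :
    IsDiscreteSubgroup (((Γ.comap (QuotientGroup.mk' (Subgroup.center SL(2, ℝ)))).map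
      (toGL : SL(2, ℝ) →* GL (Fin 2) ℝ))) := by
  haveI := discreteTopology_comap_psl Γ
  exact isDiscreteSubgroup_map_toGL_of_discreteTopology _

/-! ### §2 (P) from a cusp, (FC) from finitely many cusp orbits -/

/-- **(P) from a cusp**: a cusp of `toGL(π⁻¹ Γ̄)` is fixed by a parabolic `toGL t`, `t ∈ π⁻¹ Γ̄`.
[cite: Shimura1971, §1.5] -/
theorem exists_parabolic_of_isCusp {c : OnePoint ℝ}
    (hc : IsCusp c (((Γ.comap (QuotientGroup.mk' (Subgroup.center SL(2, ℝ)))).map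
      (toGL : SL(2, ℝ) →* GL (Fin 2) ℝ)))) :
    ∃ t : SL(2, ℝ), QuotientGroup.mk' (Subgroup.center SL(2, ℝ)) t ∈ Γ ∧
      (t : Matrix (Fin 2) (Fin 2) ℝ).IsParabolic := by
  obtain ⟨G, hG, hpar, -⟩ := hc
  obtain ⟨t, ht, rfl⟩ := Subgroup.mem_map.mp hG
  exact ⟨t, ht, hpar⟩

/-- **(FC) from finitely many cusp orbits** (the dictionary of `…PSLArithmeticCusps.lean` §1, for an
arbitrary `Γ̄`): if `toGL(π⁻¹ Γ̄)` has finitely many orbits on its cusps, then finitely many vectors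
represent all eigenlines of parabolic lifts up to `π⁻¹ Γ̄`. [cite: Shimura1971, §1.5]
[cite: MochizukiAbsTopIII2015, Proposition 4.2 (i) proof p.106] -/
theorem exists_finset_cusps_of_finite_cuspOrbits
    [hfin : Finite (CuspOrbits (((Γ.comap (QuotientGroup.mk' (Subgroup.center SL(2, ℝ)))).map
      (toGL : SL(2, ℝ) →* GL (Fin 2) ℝ))))] :
    ∃ F : Finset (Fin 2 → ℝ), ∀ t : SL(2, ℝ),
      QuotientGroup.mk' (Subgroup.center SL(2, ℝ)) t ∈ Γ → (t : Matrix (Fin 2) (Fin 2) ℝ).IsParabolic →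
      ∀ v : Fin 2 → ℝ, v ≠ 0 → (∃ c : ℝ, (t : Matrix (Fin 2) (Fin 2) ℝ) *ᵥ v = c • v) →
      ∃ g : SL(2, ℝ), QuotientGroup.mk' (Subgroup.center SL(2, ℝ)) g ∈ Γ ∧ ∃ w ∈ F, ∃ c : ℝ,
        (g : Matrix (Fin 2) (Fin 2) ℝ) *ᵥ v = c • w := by
  classical
  set A : Subgroup (GL (Fin 2) ℝ) := ((Γ.comap (QuotientGroup.mk' (Subgroup.center SL(2, ℝ)))).map
      (toGL : SL(2, ℝ) →* GL (Fin 2) ℝ)) with hA_def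
  haveI : Fintype (CuspOrbits A) := Fintype.ofFinite _
  let vec : CuspOrbits A → (Fin 2 → ℝ) := fun o =>
    (OnePoint.equivProjectivization ℝ ((Quotient.out o : cuspsSubMulAction A) : OnePoint ℝ)).rep
  refine ⟨Finset.univ.image vec, fun t ht hpar v hv ⟨c, hc⟩ => ?_⟩
  have htA : (toGL t : GL (Fin 2) ℝ) ∈ A := Subgroup.mem_map.mpr ⟨t, ht, rfl⟩
  have hcusp : IsCusp ((OnePoint.equivProjectivization ℝ).symm (Projectivization.mk ℝ v hv)) A :=
    ⟨toGL t, htA, hpar, toGL_smul_eq_self_of_mulVec_eq_smul t hv hc⟩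
  let x : cuspsSubMulAction A := ⟨(OnePoint.equivProjectivization ℝ).symm (Projectivization.mk ℝ v hv),
    hcusp⟩
  let o : CuspOrbits A := Quotient.mk (orbitRel A (cuspsSubMulAction A)) x
  have ho : (Quotient.out o : cuspsSubMulAction A) ∈ orbit A x :=
    orbitRel_apply.mp (Quotient.exact (Quotient.out_eq o))
  obtain ⟨a, ha⟩ := mem_orbit_iff.mp ho
  obtain ⟨g, hg, hga⟩ := Subgroup.mem_map.mp a.2
  have hval : (toGL g : GL (Fin 2) ℝ) • (OnePoint.equivProjectivization ℝ).symm
      (Projectivization.mk ℝ v hv) = ((Quotient.out o : cuspsSubMulAction A) : OnePoint ℝ) := by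
    rw [hga, ← ha, SubMulAction.val_smul, Subgroup.smul_def]
  refine ⟨g, hg, vec o, Finset.mem_image_of_mem vec (Finset.mem_univ o), ?_⟩
  rw [toGL_smul_equivProjectivization_symm_mk, ← exists_equivProjectivization_symm_mk_eq
    ((Quotient.out o : cuspsSubMulAction A) : OnePoint ℝ), equivProjectivization_symm_mk_eq_iff] at hval
  obtain ⟨a', ha'⟩ := hval
  exact ⟨a', ha'.symm⟩

/-! ### §3 Finite covolume -/

/-- **(FC) for FINITE-COVOLUME `Γ̄`**: if `Γ̄` acts properly discontinuously on `ℍ` and `toGL(π⁻¹ Γ̄)`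
has a measurable fundamental domain of finite hyperbolic area, the cusp classes are finitely many
(the tree's `Fuchsian.finite_cuspOrbits` — Siegel/Iwaniec Prop. 2.3–2.4 — through the dictionary).
[cite: Iwaniec2002, Prop. 2.3–2.4, PDF pp. 28–29] [cite: MochizukiAbsTopIII2015, Proposition 4.2 (i) proof p.106] -/
theorem exists_finset_cusps_of_finite_covolume [ProperlyDiscontinuousSMul Γ ℍ] {F : Set ℍ}
    (hF : IsHypFundamentalDomain (((Γ.comap (QuotientGroup.mk' (Subgroup.center SL(2, ℝ)))).map
      (toGL : SL(2, ℝ) →* GL (Fin 2) ℝ))) F)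
    (hvol : volume F < ⊤) :
    ∃ F : Finset (Fin 2 → ℝ), ∀ t : SL(2, ℝ),
      QuotientGroup.mk' (Subgroup.center SL(2, ℝ)) t ∈ Γ → (t : Matrix (Fin 2) (Fin 2) ℝ).IsParabolic →
      ∀ v : Fin 2 → ℝ, v ≠ 0 → (∃ c : ℝ, (t : Matrix (Fin 2) (Fin 2) ℝ) *ᵥ v = c • v) →
      ∃ g : SL(2, ℝ), QuotientGroup.mk' (Subgroup.center SL(2, ℝ)) g ∈ Γ ∧ ∃ w ∈ F, ∃ c : ℝ,
        (g : Matrix (Fin 2) (Fin 2) ℝ) *ᵥ v = c • w := by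
  haveI := Literature.NumberTheory.Automorphic.Fuchsian.finite_cuspOrbits (map_toGL_comap_le_range Γ)
    (neg_one_mem_map_toGL_comap Γ) (isDiscreteSubgroup_map_toGL_comap Γ) hF hvol
  exact exists_finset_cusps_of_finite_cuspOrbits Γ

/-- **A cusp exists when `ℍ/Γ̄` is not compact** (finite covolume): by the compact core
(`Fuchsian.exists_cuspSystem_and_compact_core`, Siegel/Iwaniec (2.5)), with no cusps every orbit
meets a compact `K`, so the orbit space is a continuous image of `K`.
[cite: Iwaniec2002, Prop. 2.3–2.5, PDF pp. 28–31] -/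
theorem exists_isCusp_of_not_compactSpace [ProperlyDiscontinuousSMul Γ ℍ] {F : Set ℍ}
    (hF : IsHypFundamentalDomain (((Γ.comap (QuotientGroup.mk' (Subgroup.center SL(2, ℝ)))).map
      (toGL : SL(2, ℝ) →* GL (Fin 2) ℝ))) F)
    (hvol : volume F < ⊤) (hX : ¬ CompactSpace (orbitRel.Quotient Γ ℍ)) :
    ∃ c : OnePoint ℝ, IsCusp c (((Γ.comap (QuotientGroup.mk' (Subgroup.center SL(2, ℝ)))).map
      (toGL : SL(2, ℝ) →* GL (Fin 2) ℝ))) := by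
  obtain ⟨h, 𝔞, σ, K, -, hinfty, hper, -, -, hK, hcover⟩ :=
    Literature.NumberTheory.Automorphic.Fuchsian.exists_cuspSystem_and_compact_core
      (map_toGL_comap_le_range Γ) (neg_one_mem_map_toGL_comap Γ) (isDiscreteSubgroup_map_toGL_comap Γ)
      hF hvol
  -- each `𝔞 i = σ i • ∞` is a cusp: the conjugate `σ_i⁻¹ A σ_i` has strict periods `ℤ ∋ 1`
  have hcuspi : ∀ i, IsCusp (𝔞 i) (((Γ.comap (QuotientGroup.mk' (Subgroup.center SL(2, ℝ)))).map
      (toGL : SL(2, ℝ) →* GL (Fin 2) ℝ))) := fun i => by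
    have h1 : (1 : ℝ) ∈ (ConjAct.toConjAct (toGL (σ i) : GL (Fin 2) ℝ)⁻¹ •
        ((Γ.comap (QuotientGroup.mk' (Subgroup.center SL(2, ℝ)))).map
          (toGL : SL(2, ℝ) →* GL (Fin 2) ℝ))).strictPeriods := by
      rw [hper i]
      exact AddSubgroup.mem_zmultiples 1
    have hc := (Subgroup.isCusp_of_mem_strictPeriods one_pos h1).smul (toGL (σ i) : GL (Fin 2) ℝ)
    rwa [smul_smul, ← map_mul, mul_inv_cancel, map_one, one_smul, hinfty i] at hc
  rcases Nat.eq_zero_or_pos h with h0 | hpos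
  · -- no cusps: every orbit meets the compact `K`, so `ℍ/Γ̄` is compact
    subst h0
    exfalso
    apply hX
    have hcov : ∀ z : ℍ, ∃ q : Γ, (q : PSL2R) • z ∈ K := by
      intro z
      obtain ⟨γ, hγ, hγz⟩ := hcover z
      rcases hγz with hz | ⟨i, -⟩
      · obtain ⟨t, ht, rfl⟩ := Subgroup.mem_map.mp hγ
        refine ⟨⟨QuotientGroup.mk' _ t, ht⟩, ?_⟩
        change (QuotientGroup.mk t : PSL2R) • z ∈ K
        rwa [psl_mk_smul, sl_smul_eq_toGL_smul]
      · exact i.elim0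
    refine ⟨?_⟩
    have hKim : (Set.univ : Set (orbitRel.Quotient Γ ℍ)) = Quotient.mk (orbitRel Γ ℍ) '' K := by
      ext x
      simp only [Set.mem_univ, Set.mem_image, true_iff]
      induction x using Quotient.inductionOn with
      | h z =>
        obtain ⟨q, hq⟩ := hcov z
        refine ⟨(q : PSL2R) • z, hq, Quotient.sound ?_⟩
        change (q : PSL2R) • z ∈ orbit Γ z
        exact mem_orbit z q
    rw [hKim]
    exact hK.image continuous_quot_mk
  · exact ⟨𝔞 ⟨0, hpos⟩, hcuspi _⟩

/-- ★ **`[N_{PSL₂(ℝ)}(Γ̄) : Γ̄] < ∞` for every non-abelian `Γ̄` of FINITE COVOLUME with NON-COMPACT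
quotient** acting properly discontinuously on `ℍ` (abc-iut-L4-d1's `finiteIndex_subgroupOf_normalizer_of_cusps`
with (P) and (FC) DISCHARGED from the tree's Fuchsian library: compact core + finitely many cusps).
[cite: MochizukiAbsTopIII2015, Proposition 4.2 (i) proof p.106] [cite: Iwaniec2002, Prop. 2.3–2.5, PDF pp. 28–31] -/
theorem finiteIndex_subgroupOf_normalizer_of_finite_covolume [ProperlyDiscontinuousSMul Γ ℍ]
    (hΓ : ∃ x y : Γ, x * y ≠ y * x) {F : Set ℍ}
    (hF : IsHypFundamentalDomain (((Γ.comap (QuotientGroup.mk' (Subgroup.center SL(2, ℝ)))).map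
      (toGL : SL(2, ℝ) →* GL (Fin 2) ℝ))) F)
    (hvol : volume F < ⊤) (hX : ¬ CompactSpace (orbitRel.Quotient Γ ℍ)) :
    (Γ.subgroupOf (Subgroup.normalizer (Γ : Set PSL2R))).FiniteIndex := by
  obtain ⟨c, hc⟩ := exists_isCusp_of_not_compactSpace Γ hF hvol hX
  exact finiteIndex_subgroupOf_normalizer_of_cusps Γ hΓ (exists_parabolic_of_isCusp Γ hc)
    (exists_finset_cusps_of_finite_covolume Γ hF hvol)

/-- ★ **… and for every non-abelian finite-index `Λ̄ ≤ Γ̄`** — the `hN` binder («Aut-finiteness of all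
finite étale covers of `ℍ/Γ̄`») at every object of `Loc(PSL₂(ℝ), Γ̄)`, from FINITE COVOLUME and
non-compactness of `ℍ/Γ̄` alone. [cite: MochizukiAbsTopIII2015, Proposition 4.2 (i) proof p.106]
[cite: Iwaniec2002, Prop. 2.3–2.5, PDF pp. 28–31] -/
theorem finiteIndex_subgroupOf_normalizer_of_finite_covolume_of_le [ProperlyDiscontinuousSMul Γ ℍ]
    {F : Set ℍ}
    (hF : IsHypFundamentalDomain (((Γ.comap (QuotientGroup.mk' (Subgroup.center SL(2, ℝ)))).map
      (toGL : SL(2, ℝ) →* GL (Fin 2) ℝ))) F)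
    (hvol : volume F < ⊤) (hX : ¬ CompactSpace (orbitRel.Quotient Γ ℍ))
    (Λ : Subgroup PSL2R) (hΛΓ : Λ ≤ Γ) [(Λ.subgroupOf Γ).FiniteIndex] (hΛ : ∃ x y : Λ, x * y ≠ y * x) :
    (Λ.subgroupOf (Subgroup.normalizer (Λ : Set PSL2R))).FiniteIndex := by
  obtain ⟨c, hc⟩ := exists_isCusp_of_not_compactSpace Γ hF hvol hX
  exact finiteIndex_subgroupOf_normalizer_of_cusps_of_le Γ Λ hΛΓ hΛ (exists_parabolic_of_isCusp Γ hc)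
    (exists_finset_cusps_of_finite_covolume Γ hF hvol)

/-- ★ **The compact/non-compact dichotomy removed**: for a non-abelian `Γ̄` of finite covolume acting
properly discontinuously on `ℍ`, every non-abelian finite-index `Λ̄ ≤ Γ̄` has finite index in its
normaliser — cusped case by the cusps, COMPACT case by abc-iut-L4-d1's
`finiteIndex_subgroupOf_normalizer_of_compactSpace` (p454159). [cite: MochizukiAbsTopIII2015, Proposition 4.2 (i) proof p.106]
[cite: Iwaniec2002, Prop. 2.3–2.5, PDF pp. 28–31] -/
theorem finiteIndex_subgroupOf_normalizer_of_finite_covolume_of_le' [ProperlyDiscontinuousSMul Γ ℍ]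
    {F : Set ℍ}
    (hF : IsHypFundamentalDomain (((Γ.comap (QuotientGroup.mk' (Subgroup.center SL(2, ℝ)))).map
      (toGL : SL(2, ℝ) →* GL (Fin 2) ℝ))) F)
    (hvol : volume F < ⊤)
    (Λ : Subgroup PSL2R) (hΛΓ : Λ ≤ Γ) [(Λ.subgroupOf Γ).FiniteIndex] (hΛ : ∃ x y : Λ, x * y ≠ y * x) :
    (Λ.subgroupOf (Subgroup.normalizer (Λ : Set PSL2R))).FiniteIndex := by
  by_cases hX : CompactSpace (orbitRel.Quotient Γ ℍ)
  · haveI := hX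
    haveI : CompactSpace (orbitRel.Quotient Λ ℍ) := compactSpace_orbitRelQuotient_of_finiteIndex Γ Λ
    haveI : ProperlyDiscontinuousSMul Λ ℍ := Subgroup.properlyDiscontinuousSMul_of_le ‹_› hΛΓ
    exact finiteIndex_subgroupOf_normalizer_of_compactSpace Λ hΛ
  · exact finiteIndex_subgroupOf_normalizer_of_finite_covolume_of_le Γ hF hvol hX Λ hΛΓ hΛ

end HolRS

end Literature.AnabelianGeometry.AbsoluteAnabelian

end
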